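import Mathlib.Data.Real.Basic
import Mathlib.Tactic.Linarith
import Mathlib.Tactic.Positivity
import Mathlib.Tactic.FieldSimp
import Mathlib.Tactic.Ring
import HarnessLib

/-!
# QUANT lane R8, T-DEC: the COMPARATIVE-ADVANTAGE lemma of the two-row regime of LEMMA W — the middle copy `l+r` of the low atom gains MORE over the bottom
# copy `l` at the top copy `A = l+r+k` than at `h`: `ϖ_A(l)·q_h(l) ≤ ϖ_A(l+r)·q_h(l+r)` — for the heavy and the light status of `(l+r, A)`; two small exact
# Handelman certificates (arm-1 gen 61, architect)

builds on p205010 (kernel theorem, internal audit signed; external expert review pending)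

Support file (`--supports stmt-CriticalPhenomena-4575`), QUANT lane seat prim-quant-arm-1 (gen 61, architect); memo
`run/shared/lean/prim/quant/prim-quant-arm-1-g61/ARCH-G61.md` §2.  Pure real algebra; standard axioms, no sorries, no definitions.  Used by the heavy-top cells
`…QuantGluedWindowHeavyTopIIH` / `…QuantGluedWindowHeavyTopL` of the two-row h-mid regime.

THE LEMMA.  Box coordinates of the family (memo §1): `d = h − l` the unit, `ν = N/d = 1 + y − c ∈ (0, y]` (the pair `(l,h)` light at `T`), `ε = r/d` with
`0 ≤ 2ε < ν`, `κ = (r+k)/d` with `ν < κ` and `yκ ≤ ν` (the bottom copy compatible with — hence heavy for — the top copy).  Powers (inverse usage rates):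
into `A`, row `l`: `ϖ_A = (κ−ν)/ν` (heavy, exact); row `l+r`: `ϖ_B = (κ+ε−ν)/(ν−2ε)` if heavy (`y(κ−ε) ≤ ν−2ε`), `ϖ_B = (1−G_A)/G_A`, `G_A = y² + (1−y)(ν−2ε)/(κ−ε)`
if light.  Into `h` (both light), in the "q-form" `q = (1−y)/ϖ = G/Z`: row `l`: `q_c = 1/c − (1−y)`; row `l+r`: `q₁ = (1−ε)/(c+(1−y)ε) − (1−y)`.
**`compAdv_heavy`, `compAdv_light`: `ϖ_A·q_c ≤ ϖ_B·q₁`**, i.e. `Φ_h(l+r)/Φ_h(l) ≤ ϖ_A(l+r)/ϖ_A(l)`: row `l+r`'s comparative advantage is at the (nearer) top copy.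
WHY IT MATTERS (memo §2): with it, the structured certificates of the heavy-top cells (row `l+r` into `A` first, or row `l` into `A` up to capacity) reduce to
arm-1 g60/61's ONE inequality `lightInc_star` (★7′) plus `topTransfer` — no further certificate per cell.  Certificates: kit j305789 (typer g23's Handelman
pipeline; heavy: 18 products of ≤ 6 of the 8 box generators; light: 32 products of ≤ 5 of 9 generators; exact rational weights; identities verified exactly);
the heavy polynomial vanishes identically at `ε = 0` (the two rows coincide) and the light one is tight there at `κ = ν/y`.

HONEST STATUS.  `GluedLemmaW` (flow form), `GluedDominatedMass`, the band, `SiblingStep`, `FarTreeRow` OPEN; RATE class (log\*) / honest sentence of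
`run/shared/lean/prim/quant/README.md` unchanged.  [this work].  Nothing here is cited as a published result.
-/

namespace Summit.CriticalPhenomena.PercolationContinuityZ3.Theorems
namespace Quant
namespace LawDec

/-- **COMPARATIVE ADVANTAGE, HEAVY MIDDLE COPY — the cleared polynomial**: with `c = 1 + y − ν`, `G₀ = y² + (1−y)ν`, `G₁′ = y²(1−ε) + (1−y)(ν−2ε)`:
`(κ+ε−ν)·ν·c·G₁′ − (κ−ν)·G₀·(ν−2ε)·(c+(1−y)ε) ≥ 0` on `0 ≤ y ≤ 1`, `0 ≤ ν ≤ y`, `0 ≤ 2ε ≤ ν`, `ν ≤ κ`, `yκ ≤ ν` (18-term Handelman certificate, kit j305789).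
[this work] -/
theorem compAdv_heavy_poly (y nu e k : ℝ) (h0 : 0 ≤ y) (h1 : 0 ≤ 1 - y) (h2 : 0 ≤ nu) (h3 : 0 ≤ y - nu) (h4 : 0 ≤ e) (h5 : 0 ≤ nu - 2 * e)
    (h6 : 0 ≤ k - nu) (h7 : 0 ≤ nu - y * k) :
    0 ≤ (k + e - nu) * nu * (1 + y - nu) * (y ^ 2 * (1 - e) + (1 - y) * (nu - 2 * e))
      - (k - nu) * (y ^ 2 + (1 - y) * nu) * (nu - 2 * e) * ((1 + y - nu) + (1 - y) * e) := by
  linarith only [mul_nonneg (mul_nonneg (mul_nonneg (mul_nonneg (h0) h0) h2) h3) h4,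
    mul_nonneg (mul_nonneg (mul_nonneg (h0) h0) h2) h4,
    mul_nonneg (mul_nonneg (mul_nonneg (mul_nonneg (h0) h0) h3) h4) h6,
    mul_nonneg (mul_nonneg (mul_nonneg (h0) h0) h4) h6,
    mul_nonneg (mul_nonneg (mul_nonneg (mul_nonneg (mul_nonneg (h0) h1) h2) h3) h4) h6,
    mul_nonneg (mul_nonneg (mul_nonneg (mul_nonneg (h0) h2) h3) h3) h4,
    mul_nonneg (mul_nonneg (mul_nonneg (h0) h2) h3) h4,
    mul_nonneg (mul_nonneg (mul_nonneg (mul_nonneg (h0) h2) h3) h4) h7,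
    mul_nonneg (mul_nonneg (mul_nonneg (h0) h2) h4) h7,
    mul_nonneg (mul_nonneg (mul_nonneg (mul_nonneg (h0) h3) h3) h4) h6,
    mul_nonneg (mul_nonneg (mul_nonneg (h0) h3) h4) h6,
    mul_nonneg (mul_nonneg (mul_nonneg (mul_nonneg (mul_nonneg (h1) h1) h3) h4) h5) h6,
    mul_nonneg (mul_nonneg (mul_nonneg (mul_nonneg (h1) h2) h4) h4) h6,
    mul_nonneg (mul_nonneg (mul_nonneg (mul_nonneg (h1) h3) h4) h5) h7,
    mul_nonneg (mul_nonneg (mul_nonneg (h1) h4) h5) h7,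
    mul_nonneg (mul_nonneg (mul_nonneg (h2) h3) h4) h5,
    mul_nonneg (mul_nonneg (mul_nonneg (h2) h3) h4) h6,
    mul_nonneg (mul_nonneg (h2) h4) h5]

/-- **COMPARATIVE ADVANTAGE, LIGHT MIDDLE COPY — the cleared polynomial**: with `c = 1 + y − ν`, `G₀ = y² + (1−y)ν`, `G₁′ = y²(1−ε) + (1−y)(ν−2ε)`:
`ν·c·(1−y)·[(1+y)(κ−ε) − (ν−2ε)]·G₁′ − (κ−ν)·G₀·(c+(1−y)ε)·[y²(κ−ε) + (1−y)(ν−2ε)] ≥ 0` on the same box with `ν − 2ε ≤ y(κ−ε)` (32-term Handelman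
certificate, kit j305789). [this work] -/
theorem compAdv_light_poly (y nu e k : ℝ) (h0 : 0 ≤ y) (h1 : 0 ≤ 1 - y) (h2 : 0 ≤ nu) (h3 : 0 ≤ y - nu) (h4 : 0 ≤ e) (h5 : 0 ≤ nu - 2 * e)
    (h6 : 0 ≤ k - nu) (h7 : 0 ≤ nu - y * k) (h8 : 0 ≤ y * (k - e) - (nu - 2 * e)) :
    0 ≤ nu * (1 + y - nu) * (1 - y) * ((1 + y) * (k - e) - (nu - 2 * e)) * (y ^ 2 * (1 - e) + (1 - y) * (nu - 2 * e))
      - (k - nu) * (y ^ 2 + (1 - y) * nu) * ((1 + y - nu) + (1 - y) * e) * (y ^ 2 * (k - e) + (1 - y) * (nu - 2 * e)) := by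
  linarith only [mul_nonneg (mul_nonneg (mul_nonneg (mul_nonneg (h0) h0) h0) h2) h7,
    mul_nonneg (mul_nonneg (mul_nonneg (mul_nonneg (h0) h0) h0) h6) h7,
    mul_nonneg (mul_nonneg (mul_nonneg (mul_nonneg (h0) h0) h2) h3) h7,
    mul_nonneg (mul_nonneg (mul_nonneg (h0) h0) h2) h7,
    mul_nonneg (mul_nonneg (mul_nonneg (mul_nonneg (h0) h0) h3) h5) h7,
    mul_nonneg (mul_nonneg (mul_nonneg (mul_nonneg (h0) h0) h3) h6) h7,
    mul_nonneg (mul_nonneg (mul_nonneg (mul_nonneg (h0) h0) h5) h5) h7,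
    mul_nonneg (mul_nonneg (mul_nonneg (h0) h0) h5) h7,
    mul_nonneg (mul_nonneg (mul_nonneg (mul_nonneg (h0) h0) h5) h7) h8,
    mul_nonneg (mul_nonneg (mul_nonneg (h0) h0) h6) h7,
    mul_nonneg (mul_nonneg (mul_nonneg (mul_nonneg (h0) h1) h2) h7) h8,
    mul_nonneg (mul_nonneg (mul_nonneg (mul_nonneg (h0) h3) h3) h7) h8,
    mul_nonneg (mul_nonneg (mul_nonneg (h0) h3) h5) h7,
    mul_nonneg (mul_nonneg (mul_nonneg (h0) h3) h6) h8,
    mul_nonneg (mul_nonneg (mul_nonneg (mul_nonneg (h0) h3) h7) h7) h8,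
    mul_nonneg (mul_nonneg (mul_nonneg (mul_nonneg (h0) h3) h7) h8) h8,
    mul_nonneg (mul_nonneg (h0) h5) h7,
    mul_nonneg (mul_nonneg (mul_nonneg (mul_nonneg (h1) h1) h5) h7) h8,
    mul_nonneg (mul_nonneg (mul_nonneg (mul_nonneg (h1) h2) h3) h3) h8,
    mul_nonneg (mul_nonneg (mul_nonneg (mul_nonneg (h1) h2) h3) h5) h8,
    mul_nonneg (mul_nonneg (mul_nonneg (mul_nonneg (h1) h2) h3) h6) h8,
    mul_nonneg (mul_nonneg (mul_nonneg (mul_nonneg (h1) h2) h3) h7) h8,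
    mul_nonneg (mul_nonneg (mul_nonneg (h1) h2) h3) h8,
    mul_nonneg (mul_nonneg (mul_nonneg (mul_nonneg (h1) h2) h3) h8) h8,
    mul_nonneg (mul_nonneg (mul_nonneg (h1) h2) h7) h8,
    mul_nonneg (mul_nonneg (mul_nonneg (mul_nonneg (h1) h3) h4) h5) h6,
    mul_nonneg (mul_nonneg (mul_nonneg (mul_nonneg (h1) h3) h4) h5) h7,
    mul_nonneg (mul_nonneg (mul_nonneg (h1) h4) h5) h7,
    mul_nonneg (mul_nonneg (mul_nonneg (h1) h5) h7) h7,
    mul_nonneg (mul_nonneg (mul_nonneg (h3) h3) h6) h8,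
    mul_nonneg (mul_nonneg (mul_nonneg (h3) h5) h7) h8,
    mul_nonneg (mul_nonneg (h5) h7) h7]

/-- **COMPARATIVE ADVANTAGE (heavy middle copy)**, division form: `0 < y < 1`, `1 ≤ c < 1 + y` (`ν := 1 + y − c`), `0 ≤ 2ε < ν < κ`, `yκ ≤ ν` ⟹
`((κ−ν)/ν)·(1/c − (1−y)) ≤ ((κ+ε−ν)/(ν−2ε))·((1−ε)/(c+(1−y)ε) − (1−y))`. [this work] -/
theorem compAdv_heavy (y c e k : ℝ) (hy0 : 0 < y) (hy1 : y < 1) (hc1 : 1 ≤ c) (hcy : c < 1 + y) (he0 : 0 ≤ e)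
    (he1 : 2 * e < 1 + y - c) (hkn : 1 + y - c < k) (hky : y * k ≤ 1 + y - c) :
    ((k - (1 + y - c)) / (1 + y - c)) * (1 / c - (1 - y))
      ≤ ((k + e - (1 + y - c)) / ((1 + y - c) - 2 * e)) * ((1 - e) / (c + (1 - y) * e) - (1 - y)) := by
  have hP := compAdv_heavy_poly y (1 + y - c) e k hy0.le (by linarith) (by linarith) (by linarith) he0 (by linarith) (by linarith) (by linarith)
  have hn0 : 0 < 1 + y - c := by linarith
  have hc0 : 0 < c := by linarith
  have hn2 : 0 < (1 + y - c) - 2 * e := by linarith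
  have hce : 0 < c + (1 - y) * e := by have := mul_nonneg (show (0:ℝ) ≤ 1 - y by linarith) he0; linarith
  have e1 : ((k - (1 + y - c)) / (1 + y - c)) * (1 / c - (1 - y)) = (k - (1 + y - c)) * (y ^ 2 + (1 - y) * (1 + y - c)) / ((1 + y - c) * c) := by
    field_simp
    ring
  have e2 : ((k + e - (1 + y - c)) / ((1 + y - c) - 2 * e)) * ((1 - e) / (c + (1 - y) * e) - (1 - y))
      = (k + e - (1 + y - c)) * (y ^ 2 * (1 - e) + (1 - y) * ((1 + y - c) - 2 * e)) / (((1 + y - c) - 2 * e) * (c + (1 - y) * e)) := by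
    rw [div_sub' hce.ne', div_mul_div_comm]
    congr 1; ring
  rw [e1, e2, div_le_div_iff₀ (mul_pos hn0 hc0) (mul_pos hn2 hce)]
  have e3 : (1 + y - (1 + y - c)) = c := by ring
  rw [e3] at hP
  nlinarith [hP]

/-- **COMPARATIVE ADVANTAGE (light middle copy)**, division form: `0 < y < 1`, `1 ≤ c < 1 + y` (`ν := 1 + y − c`), `0 ≤ 2ε < ν < κ`, `yκ ≤ ν`,
`ν − 2ε ≤ y(κ−ε)`, `ρ = (ν−2ε)/(κ−ε)` ⟹ `((κ−ν)/ν)·(1/c − (1−y)) ≤ ((1 − (y²+(1−y)ρ))/(y²+(1−y)ρ))·((1−ε)/(c+(1−y)ε) − (1−y))`. [this work] -/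
theorem compAdv_light (y c e k ρ : ℝ) (hy0 : 0 < y) (hy1 : y < 1) (hc1 : 1 ≤ c) (hcy : c < 1 + y) (he0 : 0 ≤ e)
    (he1 : 2 * e < 1 + y - c) (hkn : 1 + y - c < k) (hky : y * k ≤ 1 + y - c) (hlight : (1 + y - c) - 2 * e ≤ y * (k - e))
    (hρ : ρ = ((1 + y - c) - 2 * e) / (k - e)) :
    ((k - (1 + y - c)) / (1 + y - c)) * (1 / c - (1 - y))
      ≤ ((1 - (y ^ 2 + (1 - y) * ρ)) / (y ^ 2 + (1 - y) * ρ)) * ((1 - e) / (c + (1 - y) * e) - (1 - y)) := by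
  have hP := compAdv_light_poly y (1 + y - c) e k hy0.le (by linarith) (by linarith) (by linarith) he0 (by linarith) (by linarith) (by linarith)
    (by linarith)
  have hn0 : 0 < 1 + y - c := by linarith
  have hc0 : 0 < c := by linarith
  have hke : 0 < k - e := by linarith
  have h1y : 0 < 1 - y := by linarith
  have hce : 0 < c + (1 - y) * e := by have := mul_nonneg h1y.le he0; linarith
  have hGA : 0 < y ^ 2 * (k - e) + (1 - y) * ((1 + y - c) - 2 * e) := by
    have := mul_nonneg h1y.le (show (0:ℝ) ≤ (1 + y - c) - 2 * e by linarith); nlinarith [mul_pos (pow_pos hy0 2) hke]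
  have e1 : ((k - (1 + y - c)) / (1 + y - c)) * (1 / c - (1 - y)) = (k - (1 + y - c)) * (y ^ 2 + (1 - y) * (1 + y - c)) / ((1 + y - c) * c) := by
    field_simp
    ring
  have hkene : k - e ≠ 0 := hke.ne'
  have eG : y ^ 2 + (1 - y) * (((1 + y - c) - 2 * e) / (k - e)) = (y ^ 2 * (k - e) + (1 - y) * ((1 + y - c) - 2 * e)) / (k - e) := by
    field_simp
    try ring
  have e2 : ((1 - (y ^ 2 + (1 - y) * ρ)) / (y ^ 2 + (1 - y) * ρ)) * ((1 - e) / (c + (1 - y) * e) - (1 - y))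
      = ((1 - y) * ((1 + y) * (k - e) - ((1 + y - c) - 2 * e))) * (y ^ 2 * (1 - e) + (1 - y) * ((1 + y - c) - 2 * e))
        / ((y ^ 2 * (k - e) + (1 - y) * ((1 + y - c) - 2 * e)) * (c + (1 - y) * e)) := by
    rw [hρ, eG, one_sub_div hke.ne', div_div_div_cancel_right₀ hke.ne', div_sub' hce.ne', div_mul_div_comm]
    congr 1; ring
  rw [e1, e2, div_le_div_iff₀ (mul_pos hn0 hc0) (mul_pos hGA hce)]
  have e3 : (1 + y - (1 + y - c)) = c := by ring
  rw [e3] at hP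
  nlinarith [hP]

end LawDec
end Quant
end Summit.CriticalPhenomena.PercolationContinuityZ3.Theorems
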